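import Literature.Analysis.FluidPDE.OnsagerCCFSFlux
import Literature.Analysis.FluidPDE.LerayHopf
import HarnessLib

/-!
# The resolved (coarse-grained) energy balance of Leray solutions on `T^d` (Drivas–Eyink 2019, Lemma 2)

Analysis/FluidPDE file recording, as a named fact (`def … : Prop`, D-0014), the one analytic
input of the Drivas–Eyink Onsager singularity theorem (the barrier
`Literature.Barriers.AnomalousDissipation.DrivasEyink2019_lemma1` of
`Literature/Barriers/AnomalousDissipation/OnsagerSingularityLeray` and its corrected,
measurable-data form, to be appended there) that the tree does not yet prove: the **global
balance of resolved energy** of a Leray solution of the forced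
Navier–Stokes equations, Drivas–Eyink, *An Onsager singularity theorem for Leray solutions of
incompressible Navier–Stokes*, Nonlinearity 32 (2019) = arXiv:1710.05205, §2, proof of Lemma 2,
the display "global balance of resolved energy":

  `½ ∫ |ū_ℓ(x,T)|² dx - ½ ∫ |(ū₀)_ℓ(x)|² dx + ∫₀ᵀ∫ Π_ℓ[u] dx dt + ∫₀ᵀ∫ ν |∇ū_ℓ|² dx dt
     - ∫₀ᵀ∫ ū_ℓ · f̄_ℓ dx dt = 0`,

obtained there by integrating the local resolved balance of Lemma 2,
`∂ₜ(½|ū_ℓ|²) + ∇·J_ℓ = -Π_ℓ - ν|∇ū_ℓ|² + ū_ℓ·f̄_ℓ`, over `T^d × [0,T]` ("which, again, holds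
for every `x ∈ T^d` and a.e. `t ∈ [0,T]` … Since `|ū_ℓ|²(x,·)/2` is absolutely continuous in
time, upon integrating we have (…) for every `T ≥ 0` and `x ∈ T^d` … each term of the integrand
… belong[s] to `L¹([0,T]; L¹(T^d))`. The Fubini theorem then gives `∫∫ ∇·J_ℓ = 0` by
space-periodicity"). Here `ū_ℓ = G_ℓ ∗ u` is the coarse-graining at scale `ℓ` by a standard
mollifier and `Π_ℓ[u] = -∇ū_ℓ : τ_ℓ(u,u)` the energy flux; since `ū_ℓ` is divergence free,
`∫ Π_ℓ[u] dx = -∫ ∇ū_ℓ : (u ⊗ u)_ℓ dx`, which is `-Torus.cetFlux` of `FluidPDE/OnsagerCCFSFlux`.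

## Transcription

* Leray solutions are the accepted `Torus.IsLerayHopfOn T ν f u₀ u` (`FluidPDE/LerayHopf`:
  forced weak solution tested against smooth divergence-free fields, `L^∞_t L²_x`, spectral
  `L²_t H¹_x`, energy inequalities, weak `L²` continuity on `(0,T]` with weak limit `u₀` at
  `0⁺`, strong attainment of the datum).
* The mollifier is the tree's `Torus.kernel ε` (`0 < ε ≤ 1/4`, `FunctionSpaces/TorusMollifier`),
  coarse-graining is the componentwise `Torus.vecConv v (kernel ε)` and the flux is
  `Torus.cetFlux (kernel ε) v = ∫ ∑ᵢⱼ ((vᵢvⱼ) ⋆ k_ε) ∂ᵢ(vⱼ ⋆ k_ε)` (both `OnsagerCCFSFlux`, shared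
  with the Cheskidov–Constantin–Friedlander–Shvydkoy decomposition, whose Euler-case balance
  `Torus.IsWeakEulerSolutionOn.energyBalance_vecConv` is discharged in
  `FluidPDE/OnsagerCCFSTestField` (`Torus.energyBalance_vecConv_holds`) — the natural template for
  discharging the present fact: the forced Navier–Stokes weak formulation
  `Torus.IsWeakNSSolutionForcedOn` adds the two *linear* pairings `ν⟪u, Δψ⟫`, `⟪f, ψ⟫` to the
  Euler one); the resolved dissipation
  is the classical `Torus.gradNormSq (vecConv (u s) (kernel ε)) = ∫ ∑ⱼ ‖∂ⱼ ū‖²` of the smooth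
  field `ū` (`TorusFluidGlue`), the energies are `Torus.kineticEnergy`.
* Hypotheses as printed (op. cit. §1, p. 3: "Leray solutions … for `ν > 0` … with solenoidal
  initial conditions `u₀ ∈ L²(T^d)` and solenoidal body forcing `f ∈ L²([0,T]; L²(T^d))`",
  repeated in Lemma 2): `0 < ν`, `MemLp u₀ 2 volume`, the force weakly divergence free at every
  time, jointly measurable on `(0,T) × T^d`, with `∫₀ᵀ∫ ‖f‖² < ∞` (solenoidality of `u₀` is part
  of being a Leray–Hopf datum and is not repeated); and the integrability
  `u ∈ L³([0,T]; L³(T^d))` that the printed proof invokes for the Fubini step ("Since Leray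
  solutions satisfy `u ∈ L³([0,T]; L³(T^d))` …", automatic for Leray–Hopf solutions when
  `d ≤ 4`) is recorded as an explicit hypothesis. (In the tree's formulation the identity would
  survive without `ν > 0` and `∇·f = 0` — `ν` enters linearly and `Torus.IsWeakNSSolutionForcedOn`
  tests against divergence-free fields only, so only the solenoidal part of `f` is seen — but the
  fact is kept at the printed generality.)
* Conclusion: the three time integrands are integrable on `(0,T)` (printed: "each term …
  belong[s] to `L¹([0,T]; L¹(T^d))`") and the balance holds on `[0,t]` for every `t ∈ (0,T]`
  (printed "for every `T ≥ 0`"; at `t = 0` the tree's `IsLerayHopfOn` does not identify the slice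
  `u 0` with the datum `u₀`, the datum entering only through `t → 0⁺` limits, so the left end is
  excluded — there the identity reads `E(ū(0)) = E(ū₀)`, which is not part of the structure).
  Signs: `E(ū(t)) - E(ū₀) = ∫₀ᵗ Π_{k_ε} - ν ∫₀ᵗ ‖∇ū‖₂² + ∫₀ᵗ∫ ⟪f̄, ū⟫` with
  `Π_{k_ε} = Torus.cetFlux = -∫ Π_ℓ dx`.

## Mathlib search

Mathlib (this pin) has no Navier–Stokes notions, no mollified energy balances (searched
`energy balance`, `Leray`, `coarse`, `resolved`: none); Bochner set integrals
`∫ s in Ioo 0 t, …`, `IntegrableOn`, group convolution are Mathlib's.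

## References

* T. D. Drivas, G. L. Eyink, *An Onsager singularity theorem for Leray solutions of
  incompressible Navier–Stokes*, Nonlinearity 32 (2019) 4465–4482 = arXiv:1710.05205, §1
  Lemma 2 and §2, proof of Lemma 2. [DrivasEyink2019]
* P. Constantin, W. E, E. S. Titi, Comm. Math. Phys. 165 (1994), 207–209 (the mollified
  balance for Euler). [ConstantinETiti1994]
-/

noncomputable section

open MeasureTheory TopologicalSpace Set Function Filter Topology
open scoped ENNReal NNReal Convolution InnerProductSpace RealInnerProductSpace

namespace Literature.Analysis.FluidPDE

namespace Torus

variable {d : Type*} [Fintype d] [DecidableEq d]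

/-- **Global balance of resolved energy for Leray solutions** (Drivas–Eyink 2019, §2, proof of
Lemma 2, the display "global balance of resolved energy":
`½∫|ū_ℓ(T)|² - ½∫|(ū₀)_ℓ|² + ∫₀ᵀ∫Π_ℓ[u] + ∫₀ᵀ∫ν|∇ū_ℓ|² - ∫₀ᵀ∫ ū_ℓ·f̄_ℓ = 0`, every term being in
`L¹`, obtained from the local resolved balance of Lemma 2 by integration over `T^d × [0,T]`).
Transcription on the flat unit torus: let `u` be a Leray–Hopf solution on `[0,T)` with viscosity
`ν > 0`, force `f` and datum `u₀` (`Torus.IsLerayHopfOn T ν f u₀ u`), with `u₀ ∈ L²`, `f`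
solenoidal (weakly divergence free at every time), jointly measurable on `(0,T) × T^d` with
`∫₀ᵀ∫‖f‖² < ∞` (the standing hypotheses of op. cit. §1, p. 3), and `u ∈ L³((0,T) × T^d)` (used
by the printed proof; automatic in dimension `≤ 4`); let `k_ε = Torus.kernel ε`, `0 < ε ≤ 1/4`,
and write
`v̄ = Torus.vecConv v k_ε`. Then `s ↦ Π_{k_ε}[u(s)]` (`Torus.cetFlux`), `s ↦ ‖∇ū(s)‖₂²`
(`Torus.gradNormSq`) and `s ↦ ∫⟪f̄(s), ū(s)⟫` are integrable on `(0,T)`, and for every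
`t ∈ (0, T]`,
`E(ū(t)) - E(ū₀) = ∫₀ᵗ Π_{k_ε}[u(s)] ds - ν ∫₀ᵗ ‖∇ū(s)‖₂² ds + ∫₀ᵗ ∫ ⟪f̄(s), ū(s)⟫ ds`
(`E = Torus.kineticEnergy`; `Torus.cetFlux = ∫ (u⊗u)_ε : ∇ū = -∫Π_ℓ dx` since `ū` is
divergence free; `t = 0` is excluded because the structure does not identify the slice `u 0`
with the datum). [cite: DrivasEyink2019, §2, proof of Lemma 2 (global balance of resolved energy)] -/
def IsLerayHopfOn.resolvedEnergyBalance : Prop :=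
  ∀ {T ν : ℝ} {f u : ℝ → UnitAddTorus d → EuclideanSpace ℝ d}
    {u₀ : UnitAddTorus d → EuclideanSpace ℝ d} (_hν : 0 < ν) (_h : IsLerayHopfOn T ν f u₀ u)
    (_hfdiv : ∀ t, FunctionSpaces.Torus.IsWeaklyDivFree (f t))
    (_hf : AEStronglyMeasurable (FunctionSpaces.Torus.stLift f) (volume.restrict (Ioo 0 T ×ˢ univ)))
    (_hf2 : ∫⁻ t in Ioo 0 T, ∫⁻ x, ‖f t x‖ₑ ^ 2 < ⊤) (_hu₀ : MemLp u₀ 2 volume)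
    (_hu3 : ∫⁻ t in Ioo 0 T, ∫⁻ x, ‖u t x‖ₑ ^ 3 < ⊤) {ε : ℝ} (_hε : 0 < ε) (_hε' : ε ≤ 1 / 4),
    IntegrableOn (fun s => cetFlux (FunctionSpaces.Torus.kernel ε) (u s)) (Ioo 0 T) ∧
    IntegrableOn (fun s => FunctionSpaces.Torus.gradNormSq (vecConv (u s) (FunctionSpaces.Torus.kernel ε))) (Ioo 0 T) ∧
    IntegrableOn (fun s => ∫ x, ⟪vecConv (f s) (FunctionSpaces.Torus.kernel ε) x, vecConv (u s) (FunctionSpaces.Torus.kernel ε) x⟫)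
      (Ioo 0 T) ∧
    ∀ t ∈ Ioc 0 T,
      FunctionSpaces.Torus.kineticEnergy (vecConv (u t) (FunctionSpaces.Torus.kernel ε)) - FunctionSpaces.Torus.kineticEnergy (vecConv u₀ (FunctionSpaces.Torus.kernel ε)) =
        (∫ s in Ioo 0 t, cetFlux (FunctionSpaces.Torus.kernel ε) (u s)) -
          ν * (∫ s in Ioo 0 t, FunctionSpaces.Torus.gradNormSq (vecConv (u s) (FunctionSpaces.Torus.kernel ε))) +
          ∫ s in Ioo 0 t, ∫ x, ⟪vecConv (f s) (FunctionSpaces.Torus.kernel ε) x, vecConv (u s) (FunctionSpaces.Torus.kernel ε) x⟫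

/-- **The balance in inequality form used by Drivas–Eyink's Lemma 1** (op. cit. §2, proof of
Lemma 1, p. 9: the inequality obtained from the global balance after dropping
`τ_ℓ(u(·,T); u(·,T)) ≥ 0` "by convexity … at the expense of an inequality", here with the
viscous dissipation in place of the total one): under the resolved energy balance, for a
Leray–Hopf solution with `ν > 0`, solenoidal measurable `L²_{t,x}` force and `0 < T`,
`ν ∫₀ᵀ ‖∇u‖₂² ≤ [E(u₀) - E(ū₀)] - ∫₀ᵀ Π_{k_ε} + ν ∫₀ᵀ ‖∇ū‖₂² + [∫₀ᵀ∫⟪f,u⟫ - ∫₀ᵀ∫⟪f̄,ū⟫]`,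
provided the coarse-grained energy at time `T` does not exceed the energy,
`E(ū(T)) ≤ E(u(T))` (the convexity step "`|ū_ℓ|² ≤ (|u|²)_ℓ`", supplied by the caller).
Proved here from the named fact and the energy inequality of `IsLerayHopfOn`. [cite: DrivasEyink2019, §2, proof of Lemma 1] -/
theorem IsLerayHopfOn.dissipation_le_of_resolvedEnergyBalance
    (hA : IsLerayHopfOn.resolvedEnergyBalance (d := d)) {T ν : ℝ}
    {f u : ℝ → UnitAddTorus d → EuclideanSpace ℝ d} {u₀ : UnitAddTorus d → EuclideanSpace ℝ d}
    (hν : 0 < ν) (h : IsLerayHopfOn T ν f u₀ u) (hT : 0 < T) (hfdiv : ∀ t, FunctionSpaces.Torus.IsWeaklyDivFree (f t))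
    (hf : AEStronglyMeasurable (FunctionSpaces.Torus.stLift f) (volume.restrict (Ioo 0 T ×ˢ univ)))
    (hf2 : ∫⁻ t in Ioo 0 T, ∫⁻ x, ‖f t x‖ₑ ^ 2 < ⊤) (hu₀ : MemLp u₀ 2 volume)
    (hu3 : ∫⁻ t in Ioo 0 T, ∫⁻ x, ‖u t x‖ₑ ^ 3 < ⊤) {ε : ℝ} (hε : 0 < ε) (hε' : ε ≤ 1 / 4)
    (hconv : FunctionSpaces.Torus.kineticEnergy (vecConv (u T) (FunctionSpaces.Torus.kernel ε)) ≤ FunctionSpaces.Torus.kineticEnergy (u T)) :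
    ν * (∫⁻ τ in Ioo 0 T, FunctionSpaces.Torus.eGradNormSq (u τ)).toReal ≤
      (FunctionSpaces.Torus.kineticEnergy u₀ - FunctionSpaces.Torus.kineticEnergy (vecConv u₀ (FunctionSpaces.Torus.kernel ε))) -
        (∫ s in Ioo 0 T, cetFlux (FunctionSpaces.Torus.kernel ε) (u s)) +
        ν * (∫ s in Ioo 0 T, FunctionSpaces.Torus.gradNormSq (vecConv (u s) (FunctionSpaces.Torus.kernel ε))) +
        ((∫ τ in 0..T, ∫ x, ⟪f τ x, u τ x⟫) -
          ∫ s in Ioo 0 T, ∫ x, ⟪vecConv (f s) (FunctionSpaces.Torus.kernel ε) x, vecConv (u s) (FunctionSpaces.Torus.kernel ε) x⟫) := by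
  obtain ⟨-, -, -, hbal⟩ := hA hν h hfdiv hf hf2 hu₀ hu3 hε hε'
  have hb := hbal T ⟨hT, le_rfl⟩
  have hen := h.energy_ineq_zero T ⟨hT.le, le_rfl⟩
  linarith

end Torus

end Literature.Analysis.FluidPDE
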